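import Summits.RiemannHypothesis.RiemannHypothesis.Theses.WeilGroundState
import Summits.RiemannHypothesis.RiemannHypothesis.Theorems.WeilGroundStateGroundStatesConvergeToXiStubMellinXi
import Summits.RiemannHypothesis.RiemannHypothesis.Theorems.WeilGroundStateGroundStatesConvergeToXiStubPsiDecay
import Literature.NumberTheory.LFunctions.WeilGroundState

/-!
# Crux `WeilGroundState.GroundStatesConvergeToXi` (stmt-RiemannHypothesis-1527) — helper
# `ConvergenceClauseNonVacuous`: the `∃`-shell of the crux minus the ground-state constraint HOLDS

Refuter's non-vacuity / load-bearing analysis for the `∃`-crux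
`∃ a_k → ∞, u_k, c_k ≠ 0, (∀ k, IsWeilGroundState (a k) (u k)) ∧ c_k · û_k → ξ loc. unif. on the
open strip`: if the ground-state constraint `IsWeilGroundState (a k) (u k)` is replaced by mere
WINDOW DATA (`u k ∈ L²`, `u k = 0` off `[-a_k, a_k]`), every other clause is satisfied by the
truncations `u_k = Φ·𝟙_{[-k-1,k+1]}` of Riemann's kernel `Φ = 2Ψ(2·)` (`Φ̂ = ξ`, landed stub
`stub_mellinXi`), with `c_k = 1` and convergence even UNIFORM on the whole open strip:
`|ξ(s) − û_k(s)| = |∫_{|t|>k+1} Φ e^{(s-1/2)t}| ≤ ∫_{|t|>k+1} |Φ| e^{|t|/2} → 0`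
(`tendstoUniformlyOn_weilMellin_truncatedPhi`, dominated convergence on the exponential moment
`|Φ| e^{|t|/2} ∈ L¹`).

Reading for the provers/planner: the analytic shell of the crux excludes nothing and grants
nothing — ALL of its content is the identification "renormalised ground states ≈ Φ" in a sense
controlling `∫ · e^{b|t|}`, `b < 1/2` (the lead's stub C⁺); compare the companion negative lemma
`Negative/NotAttained.lean` (the identification is never EXACT at a finite window).

No Theses declaration is asserted here (helper on the Negative/ lane).
-/

set_option linter.dupNamespace false

noncomputable section

open MeasureTheory Complex Filter Set
open scoped Real Topology

namespace Summit.RiemannHypothesis.RiemannHypothesis.Theorems.GroundStatesConvergeToXi.Negative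

open Literature.NumberTheory.LFunctions
open Summit.RiemannHypothesis.RiemannHypothesis.Theorems.GroundStatesConvergeToXi

/-- `Φ` is bounded: `‖Φ(t)‖ ≤ M`. [folklore] -/
theorem exists_norm_phi_le :
    ∃ M : ℝ, 0 ≤ M ∧ ∀ t : ℝ, ‖(2 : ℂ) * LagariasMontague.Psic (2 * t)‖ ≤ M := by
  obtain ⟨C, hC⟩ := stub_psiDecay.1 0
  refine ⟨2 * |C|, by positivity, fun t => ?_⟩
  rw [norm_phi]
  have h := hC (2 * t)
  simp only [zero_mul, neg_zero, Real.exp_zero, mul_one] at h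
  nlinarith [abs_nonneg (LagariasMontague.Psi (2 * t)), le_abs_self C]

/-- `Φ ∈ L¹(ℝ)`. [folklore] -/
theorem integrable_phi : Integrable (fun t : ℝ => (2 : ℂ) * LagariasMontague.Psic (2 * t)) := by
  simpa using integrable_phi_mul_cexp stub_psiDecay.2 (1 / 2)

/-- `Φ ∈ L²(ℝ)` (bounded and integrable). [folklore] -/
theorem memLp_phi : MemLp (fun t : ℝ => (2 : ℂ) * LagariasMontague.Psic (2 * t)) 2 := by
  obtain ⟨M, hM0, hM⟩ := exists_norm_phi_le
  refine (memLp_two_iff_integrable_sq_norm integrable_phi.aestronglyMeasurable).2 ?_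
  refine (integrable_phi.norm.const_mul M).mono'
    ((continuous_phi.norm.pow 2).aestronglyMeasurable) (ae_of_all _ fun t => ?_)
  rw [Real.norm_of_nonneg (by positivity), sq]
  exact mul_le_mul_of_nonneg_right (hM t) (norm_nonneg _)

/-- The weight `‖Φ(t)‖ e^{|t|/2}` is integrable (exponential moments of `Ψ`). [folklore] -/
theorem integrable_norm_phi_mul_exp_half :
    Integrable fun t : ℝ => ‖(2 : ℂ) * LagariasMontague.Psic (2 * t)‖ * Real.exp (|t| / 2) := by
  refine (((stub_psiDecay.2 (1 / 2)).norm).const_mul 2).congr (ae_of_all _ fun t => ?_)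
  dsimp only
  rw [norm_phi, Real.norm_eq_abs, abs_mul, abs_of_pos (Real.exp_pos _)]
  have : (1 / 2 : ℝ) * |t| = |t| / 2 := by ring
  rw [this]
  ring

/-- On the open strip the Mellin weight is dominated by `e^{|t|/2}`:
`‖e^{(s-1/2)t}‖ ≤ e^{|t|/2}` for `0 < Re s < 1`. [folklore] -/
theorem norm_cexp_le_exp_half {s : ℂ} (hs : 0 < s.re ∧ s.re < 1) (t : ℝ) :
    ‖cexp ((s - 1 / 2) * (t : ℂ))‖ ≤ Real.exp (|t| / 2) := by
  rw [Complex.norm_exp, Real.exp_le_exp]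
  have hre : ((s - 1 / 2) * (t : ℂ)).re = (s.re - 1 / 2) * t := by
    simp [Complex.mul_re]
  rw [hre]
  have h1 : |s.re - 1 / 2| ≤ 1 / 2 := abs_le.2 ⟨by linarith [hs.1], by linarith [hs.2]⟩
  calc (s.re - 1 / 2) * t ≤ |(s.re - 1 / 2) * t| := le_abs_self _
    _ = |s.re - 1 / 2| * |t| := abs_mul _ _
    _ ≤ 1 / 2 * |t| := mul_le_mul_of_nonneg_right h1 (abs_nonneg t)
    _ = |t| / 2 := by ring

/-- **Truncations of `Φ` have Mellin transforms converging to `ξ` UNIFORMLY on the open strip**: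
`|ξ(s) − (Φ𝟙_{[-k-1,k+1]})^(s)| ≤ ∫_{|t|>k+1} ‖Φ‖ e^{|t|/2} → 0`. [folklore] -/
theorem tendstoUniformlyOn_weilMellin_truncatedPhi :
    TendstoUniformlyOn
      (fun (k : ℕ) (s : ℂ) => weilMellin ((Icc (-((k : ℝ) + 1)) ((k : ℝ) + 1)).indicator
        (fun t : ℝ => (2 : ℂ) * LagariasMontague.Psic (2 * t))) s)
      riemannXi atTop {s : ℂ | 0 < s.re ∧ s.re < 1} := by
  set Φ : ℝ → ℂ := fun t => 2 * LagariasMontague.Psic (2 * t) with hΦ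
  set g : ℝ → ℝ := fun t => ‖Φ t‖ * Real.exp (|t| / 2) with hg
  have hgint : Integrable g := integrable_norm_phi_mul_exp_half
  set I : ℕ → Set ℝ := fun k => Icc (-((k : ℝ) + 1)) ((k : ℝ) + 1) with hI
  have hIm : ∀ k, MeasurableSet (I k) := fun k => measurableSet_Icc
  -- the tail functional `T k = ∫_{(I k)ᶜ} g → 0`
  set T : ℕ → ℝ := fun k => ∫ t, (I k)ᶜ.indicator g t with hT
  have hT : Tendsto T atTop (𝓝 0) := by
    have h := tendsto_integral_of_dominated_convergence (μ := volume) (bound := g)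
      (F := fun k t => (I k)ᶜ.indicator g t) (f := fun _ => (0 : ℝ))
      (fun k => (hgint.aestronglyMeasurable.indicator (hIm k).compl)) hgint
      (fun k => ae_of_all _ fun t => by
        rw [Real.norm_eq_abs, Set.indicator_apply]
        split_ifs
        · exact (abs_of_nonneg (by positivity)).le
        · simpa using (show 0 ≤ g t by positivity))
      (ae_of_all _ fun t => by
        refine tendsto_const_nhds.congr' ?_
        filter_upwards [eventually_gt_atTop ⌈|t|⌉₊] with k hk
        have hk' : |t| < (k : ℝ) + 1 := by
          have := Nat.le_ceil |t|
          have hk2 : (⌈|t|⌉₊ : ℝ) < k := by exact_mod_cast hk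
          linarith
        have hmem : t ∈ I k := by
          simp only [hI, mem_Icc]
          constructor <;> linarith [le_abs_self t, neg_abs_le t]
        rw [Set.indicator_of_notMem (Set.notMem_compl_iff.2 hmem)])
    simpa using h
  rw [Metric.tendstoUniformlyOn_iff]
  intro ε hε
  filter_upwards [hT.eventually (eventually_lt_nhds hε)] with k hk s hs
  -- `ξ(s) − (Φ𝟙)^(s) = ∫ 𝟙_{(I k)ᶜ} Φ e^{(s-1/2)t}`
  have h1 : Integrable fun t : ℝ => Φ t * cexp ((s - 1 / 2) * t) :=
    integrable_phi_mul_cexp stub_psiDecay.2 s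
  have h2 : Integrable fun t : ℝ => (I k).indicator Φ t * cexp ((s - 1 / 2) * t) := by
    refine (h1.indicator (hIm k)).congr (ae_of_all _ fun t => ?_)
    simp only [Set.indicator_apply]
    split_ifs <;> simp
  have hdiff : riemannXi s - weilMellin ((I k).indicator Φ) s =
      ∫ t : ℝ, (I k)ᶜ.indicator Φ t * cexp ((s - 1 / 2) * t) := by
    rw [← stub_mellinXi stub_psiDecay.1 stub_psiDecay.2 s]
    unfold weilMellin
    rw [← integral_sub h1 h2]
    refine integral_congr_ae (ae_of_all _ fun t => ?_)
    dsimp only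
    rw [Set.indicator_compl, Pi.sub_apply]
    ring
  rw [dist_eq_norm, hdiff]
  calc ‖∫ t : ℝ, (I k)ᶜ.indicator Φ t * cexp ((s - 1 / 2) * t)‖
      ≤ ∫ t : ℝ, ‖(I k)ᶜ.indicator Φ t * cexp ((s - 1 / 2) * t)‖ :=
        norm_integral_le_integral_norm _
    _ ≤ ∫ t : ℝ, (I k)ᶜ.indicator g t := by
        refine integral_mono_of_nonneg (ae_of_all _ fun t => norm_nonneg _)
          (hgint.indicator (hIm k).compl) (ae_of_all _ fun t => ?_)
        simp only [Set.indicator_apply, hg]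
        split_ifs with ht
        · rw [norm_mul]
          exact mul_le_mul_of_nonneg_left (norm_cexp_le_exp_half hs t) (norm_nonneg _)
        · simp
    _ = T k := rfl
    _ < ε := hk

/-- **The `∃`-shell of the crux without the ground-state constraint is inhabited**: there are
windows `a_k → ∞`, functions `u_k ∈ L²` vanishing off `[-a_k, a_k]` and constants `c_k ≠ 0` with
`c_k · weilMellin u_k → ξ` locally uniformly (indeed uniformly) on the open critical strip —
namely `a_k = k+1`, `u_k = Φ𝟙_{[-k-1,k+1]}`, `c_k = 1`.  So the crux `GroundStatesConvergeToXi`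
is exactly as strong as its ground-state clause makes it. [folklore] -/
theorem convergenceClause_without_groundState_nonvacuous :
    ∃ a : ℕ → ℝ, ∃ u : ℕ → ℝ → ℂ, ∃ c : ℕ → ℂ, Tendsto a atTop atTop ∧
      (∀ k, 0 < a k ∧ c k ≠ 0 ∧ MemLp (u k) 2 ∧ ∀ t, t ∉ Icc (-(a k)) (a k) → u k t = 0) ∧
      TendstoLocallyUniformlyOn (fun k s => c k * weilMellin (u k) s) riemannXi atTop
        {s : ℂ | 0 < s.re ∧ s.re < 1} := by
  refine ⟨fun k => (k : ℝ) + 1,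
    fun k => (Icc (-((k : ℝ) + 1)) ((k : ℝ) + 1)).indicator
      (fun t : ℝ => (2 : ℂ) * LagariasMontague.Psic (2 * t)),
    fun _ => 1, ?_, fun k => ⟨by positivity, one_ne_zero, ?_, fun t ht => ?_⟩, ?_⟩
  · exact tendsto_atTop_add_const_right _ 1 tendsto_natCast_atTop_atTop
  · exact memLp_phi.indicator measurableSet_Icc
  · exact Set.indicator_of_notMem ht _
  · have e : (fun (k : ℕ) (s : ℂ) => (1 : ℂ) * weilMellin ((Icc (-((k : ℝ) + 1)) ((k : ℝ) + 1)).indicator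
        (fun t : ℝ => (2 : ℂ) * LagariasMontague.Psic (2 * t))) s) =
        fun (k : ℕ) (s : ℂ) => weilMellin ((Icc (-((k : ℝ) + 1)) ((k : ℝ) + 1)).indicator
        (fun t : ℝ => (2 : ℂ) * LagariasMontague.Psic (2 * t))) s := by
      funext k s
      exact one_mul _
    rw [e]
    exact tendstoUniformlyOn_weilMellin_truncatedPhi.tendstoLocallyUniformlyOn

end Summit.RiemannHypothesis.RiemannHypothesis.Theorems.GroundStatesConvergeToXi.Negative

end
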